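import Summits.ResolutionOfSingularities.ResolutionOfSingularities.Theorems.EquisingularLiftEquisingularLiftCentreBlowupFlatExceptional
import Summits.ResolutionOfSingularities.ResolutionOfSingularities.Theorems.EquisingularLiftEquisingularLiftIntegralFlatOfGoodAt
import Summits.ResolutionOfSingularities.ResolutionOfSingularities.Theorems.EquisingularLiftEquisingularLiftGoodAtOfSmooth
import Literature.AlgebraicGeometry.Resolution.BlowupsProperProofs
import Literature.AlgebraicGeometry.Resolution.BlowupsIntegral
import Literature.AlgebraicGeometry.Resolution.RegularBlowup
import Literature.AlgebraicGeometry.Resolution.AlterationsLemma32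
import HarnessLib

/-!
# `EquisingularLift`, line `Sketch` — along a liftable chain the special fibre stays irreducible (S9, modulo S8)

Crux `stmt-ResolutionOfSingularities-15660` = `Theses.EquisingularLift.EquisingularLift`; global layer of the `n = 3` split
(planner draft `L/w45b/sketch-v8.lean`, stub S9 `stub_isIrreducible_of_liftableChain`), here with the route-posited notion
`LiftableChain` UNFOLDED (its definition file is not yet in the tree; the registered stub follows by definitional unfolding).

A LIFTABLE CHAIN over `Spec O` is EL's recursor-encoded chain of blow-ups `P = P₀ ← P₁ ← ⋯ ← P_m = P'` in REGULAR centres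
`Cᵢ ⊆ Pᵢ` which are moreover FLAT over `O` and do not contain the running special fibre. CLAIM
(`isIrreducible_of_liftableChain`): if `P → Spec O` (`O` a DVR) is smooth and proper with irreducible special fibre, then —
GIVEN the one-step statement S8 (one blow-up of an integral locally Noetherian `X'/O` along a centre not containing the special
fibre and with `O`-flat exceptional divisor keeps the special fibre irreducible) — the special fibre of `P' → Spec O` is
irreducible.

Proof: induction along the chain with motive "`X'` integral ∧ locally Noetherian ∧ regular ∧ irreducible special fibre"
(`liftableChain_integral_regular_irreducible`). Base: `P` is regular (smooth over the regular `Spec O`, EGA IV₄ 17.5.8 (iii)),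
locally Noetherian, and integral (`isIntegral_and_flat_of_goodAt`: proper, regular, irreducible special fibre, good reduction
at a point of it by `stub_goodAtOfSmooth`). Step `τ : X'' → X'` along `C`: `C ≠ ⊥` (its support misses a point of the special
fibre), so `X''` is integral (`IsBlowup.isIntegral`); `τ` is proper (Stacks 02NS, `stacks02NS_holds`), so `X''` is locally
Noetherian; `X''` is regular (Liu 8.1.19 (a), `IsBlowup.isRegular_of_isRegular_subscheme`); the exceptional divisor is flat
over `O` (H1 = `flat_exceptional_of_isBlowup_regularCentre`, p460210: `X'` regular, `C` regular and `O`-flat), so S8 applies.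

References: Q. Liu, *Algebraic Geometry and Arithmetic Curves*, OUP 2002, Thm. 8.1.19; The Stacks Project, Tags 02ND,
02NS, 0805.
-/

set_option linter.dupNamespace false -- mandated namespace `Summit.<Summit>.<Problem>` of this single-conjunct summit
set_option linter.overlappingInstances false -- the signatures carry both [IsDomain O] and [IsDiscreteValuationRing O]

noncomputable section

namespace Summit.ResolutionOfSingularities.ResolutionOfSingularities.Cruxes.EquisingularLift.StrataSplit

open CategoryTheory CategoryTheory.Limits AlgebraicGeometry TopologicalSpace Topology
open IsLocalRing Literature.AlgebraicGeometry.Resolution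
open Summit.ResolutionOfSingularities.ResolutionOfSingularities.Theses.EquisingularLift.Split

/-! ## The induction along a liftable chain -/

/-- **Motive propagation along a liftable chain.** Let `O` be a DVR, `q : P → Spec O` with `P` integral, locally
Noetherian and regular and with irreducible special fibre, and let `(P', σ, S')` be reached from `(P, 𝟙, Y)` by a liftable
chain (regular `O`-flat centres not containing the running special fibre — the predicate `LiftableChain` of the line,
unfolded). GIVEN the one-step irreducibility statement S8, the end `P'` is again integral, locally Noetherian and regular
with irreducible special fibre. [folklore; Liu2002 Thm. 8.1.19 (a), Stacks 02ND/02NS for the step] -/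
theorem liftableChain_integral_regular_irreducible
    (h₈ : ∀ (O : Type) [CommRing O] [IsDomain O] [IsDiscreteValuationRing O] (X' X'' : AlgebraicGeometry.Scheme.{0}) [AlgebraicGeometry.IsIntegral X'] [AlgebraicGeometry.IsLocallyNoetherian X'] (r' : X' ⟶ AlgebraicGeometry.Spec (.of O)) (C : X'.IdealSheafData) (τ : X'' ⟶ X'), Literature.AlgebraicGeometry.Resolution.IsBlowup τ C → AlgebraicGeometry.Flat (CategoryTheory.CategoryStruct.comp (C.comap τ).subschemeι (CategoryTheory.CategoryStruct.comp τ r')) → ¬ (r' ⁻¹' {IsLocalRing.closedPoint O} ⊆ (C.support : Set X')) → IsIrreducible (r' ⁻¹' {IsLocalRing.closedPoint O}) → IsIrreducible ((CategoryTheory.CategoryStruct.comp τ r') ⁻¹' {IsLocalRing.closedPoint O}))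
    (O : Type) [CommRing O] [IsDomain O] [IsDiscreteValuationRing O] (P P' : Scheme.{0})
    (q : P ⟶ Spec (.of O)) (Y : Set P) (σ : P' ⟶ P) (S' : Set P') [IsIntegral P] [IsLocallyNoetherian P]
    (hPreg : Scheme.IsRegular P) (hirr : IsIrreducible (q ⁻¹' {closedPoint O}))
    (hL : ∀ Q : (∀ X' : AlgebraicGeometry.Scheme.{0}, (X' ⟶ P) → Set X' → Prop), Q P (CategoryTheory.CategoryStruct.id P) Y → (∀ (X' X'' : AlgebraicGeometry.Scheme.{0}) (σ' : X' ⟶ P) (Y' : Set X') (C : X'.IdealSheafData) (τ : X'' ⟶ X'), Q X' σ' Y' → Literature.AlgebraicGeometry.Resolution.IsBlowup τ C → Literature.AlgebraicGeometry.Resolution.Scheme.IsRegular C.subscheme → AlgebraicGeometry.Flat (CategoryTheory.CategoryStruct.comp C.subschemeι (CategoryTheory.CategoryStruct.comp σ' q)) → ¬ ((CategoryTheory.CategoryStruct.comp σ' q) ⁻¹' {IsLocalRing.closedPoint O} ⊆ (C.support : Set X')) → σ' '' (C.support : Set X') ⊆ {x : P | ¬ IsGenericPoint x Y} → Q X'' (CategoryTheory.CategoryStruct.comp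 τ σ') (closure (τ ⁻¹' (Y' \ (C.support : Set X'))))) → Q P' σ S') :
    IsIntegral P' ∧ IsLocallyNoetherian P' ∧ Scheme.IsRegular P' ∧
      IsIrreducible ((σ ≫ q) ⁻¹' {closedPoint O}) := by
  refine hL (fun X' σ' _ => IsIntegral X' ∧ IsLocallyNoetherian X' ∧ Scheme.IsRegular X' ∧
      IsIrreducible ((σ' ≫ q) ⁻¹' {closedPoint O})) ⟨‹_›, ‹_›, hPreg, by rwa [Category.id_comp]⟩ ?_
  rintro X' X'' σ' Y' C τ ⟨hint, hNoeth, hreg, hirr'⟩ hτ hCreg hCflat hnot -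
  haveI := hint
  haveI := hNoeth
  haveI := hCflat
  -- the centre is a genuine ideal sheaf: its support misses a point of the special fibre
  have hC : C ≠ ⊥ := by
    rintro rfl
    apply hnot
    rw [Scheme.IdealSheafData.support_bot]
    exact fun _ _ => trivial
  -- `X''` is integral (Stacks 02ND) and locally Noetherian (`τ` is proper, Stacks 02NS)
  haveI : IsIntegral X'' := hτ.isIntegral hC
  haveI : IsProper τ := stacks02NS_holds.of_isLocallyNoetherian τ C hτ
  haveI : IsLocallyNoetherian X'' := LocallyOfFiniteType.isLocallyNoetherian τ
  -- `X''` is regular (Liu 8.1.19 (a))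
  have hreg'' : Scheme.IsRegular X'' := hτ.isRegular_of_isRegular_subscheme hreg hCreg
  -- the exceptional divisor is flat over `O` (H1), so S8 applies
  have hflatE := flat_exceptional_of_isBlowup_regularCentre O X' X'' (σ' ≫ q) C hreg hCreg hCflat τ hτ
  have hirr'' := h₈ O X' X'' (σ' ≫ q) C τ hτ hflatE hnot hirr'
  refine ⟨‹_›, ‹_›, hreg'', ?_⟩
  rwa [Category.assoc]

/-! ## S9 with `LiftableChain` unfolded -/

/-- **Along a liftable chain from a smooth proper `P → Spec O` with irreducible special fibre, the special fibre stays
irreducible** (stub S9 of the planner's v8 draft, with the route-posited `LiftableChain` unfolded), GIVEN the one-step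
statement S8. The base of the induction: `P` is regular (smooth over the regular `Spec O`), locally Noetherian, and integral
(proper + regular + irreducible special fibre + good reduction at one of its points, `isIntegral_and_flat_of_goodAt` with
`stub_goodAtOfSmooth`); then `liftableChain_integral_regular_irreducible`. [folklore] -/
theorem isIrreducible_of_liftableChain : (∀ (O : Type) [CommRing O] [IsDomain O] [IsDiscreteValuationRing O] (X' X'' : AlgebraicGeometry.Scheme.{0}) [AlgebraicGeometry.IsIntegral X'] [AlgebraicGeometry.IsLocallyNoetherian X'] (r' : X' ⟶ AlgebraicGeometry.Spec (.of O)) (C : X'.IdealSheafData) (τ : X'' ⟶ X'), Literature.AlgebraicGeometry.Resolution.IsBlowup τ C → AlgebraicGeometry.Flat (CategoryTheory.CategoryStruct.comp (C.comap τ).subschemeι (CategoryTheory.CategoryStruct.comp τ r')) → ¬ (r' ⁻¹' {IsLocalRing.closedPoint O} ⊆ (C.support : Set X')) → IsIrreducible (r' ⁻¹' {IsLocalRing.closedPoint O}) → IsIrreducible ((CategoryTheory.CategoryStruct.comp τ r') ⁻¹' {IsLocalRing.closedPoint O})) → ∀ (O : Type) [CommRing O] [IsDomain O] [IsDiscreteValuationRing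 O] (P P' : AlgebraicGeometry.Scheme.{0}) (q : P ⟶ AlgebraicGeometry.Spec (.of O)) (Y : Set P) (σ : P' ⟶ P) (S' : Set P'), AlgebraicGeometry.Smooth q → AlgebraicGeometry.IsProper q → IsIrreducible (q ⁻¹' {IsLocalRing.closedPoint O}) → (∀ Q : (∀ X' : AlgebraicGeometry.Scheme.{0}, (X' ⟶ P) → Set X' → Prop), Q P (CategoryTheory.CategoryStruct.id P) Y → (∀ (X' X'' : AlgebraicGeometry.Scheme.{0}) (σ' : X' ⟶ P) (Y' : Set X') (C : X'.IdealSheafData) (τ : X'' ⟶ X'), Q X' σ' Y' → Literature.AlgebraicGeometry.Resolution.IsBlowup τ C → Literature.AlgebraicGeometry.Resolution.Scheme.IsRegular C.subscheme → AlgebraicGeometry.Flat (CategoryTheory.CategoryStruct.comp C.subschemeι (CategoryTheory.CategoryStruct.comp σ' q)) → ¬ ((CategoryTheory.CategoryStruct.comp σ' q) ⁻¹' {IsLocalRing.closedPoint O} ⊆ (C.support : Set X')) → σ' '' (C.support : Set X') ⊆ {x : P | ¬ IsGenericPoint x Y} → Q X'' (CategoryTheory.CategoryStruct.comp τ σ')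 (closure (τ ⁻¹' (Y' \ (C.support : Set X'))))) → Q P' σ S') → IsIrreducible ((CategoryTheory.CategoryStruct.comp σ q) ⁻¹' {IsLocalRing.closedPoint O}) := by
  intro h₈ O _ _ _ P P' q Y σ S' hsm hpr hirr hL
  haveI := hsm
  haveI := hpr
  -- the base: `P` is locally Noetherian, regular and integral
  haveI : IsLocallyNoetherian P := LocallyOfFiniteType.isLocallyNoetherian q
  haveI : IsRegularRing (CommRingCat.of O) := inferInstanceAs (IsRegularRing O)
  have hPreg : Scheme.IsRegular P := Scheme.IsRegular.of_smooth q (Scheme.isRegular_Spec (.of O))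
  obtain ⟨x, hx⟩ := hirr.nonempty
  have hgood : GoodAt q x := stub_goodAtOfSmooth O P q hsm x
  obtain ⟨hint, -, -⟩ := isIntegral_and_flat_of_goodAt O P q inferInstance hPreg hirr ⟨x, hx, hgood⟩
  haveI := hint
  exact (liftableChain_integral_regular_irreducible h₈ O P P' q Y σ S' hPreg hirr hL).2.2.2

end Summit.ResolutionOfSingularities.ResolutionOfSingularities.Cruxes.EquisingularLift.StrataSplit

end
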